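import Literature.Geometry.Kaehler.ComplexTorusCorrespondenceRingHodgeEndomorphisms
import Literature.Geometry.Kaehler.ComplexTorusDualHodgeStructure
import Literature.Geometry.Kaehler.ComplexTorusLefschetzGroupIdentityComponent
import Literature.Geometry.Kaehler.ComplexTorusLefschetzGroupProductIdentityComponent
import Literature.Geometry.Kaehler.ComplexTorusCorrespondenceAction
import Literature.Geometry.Kaehler.ComplexTorusHodgeDecomposition
import Literature.AlgebraicGeometry.Motives.HodgeStructureLefschetzGroupPoints
import Literature.AlgebraicGeometry.Motives.HodgeStructureDeligneTorusMumfordTate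
import Literature.AlgebraicGeometry.Motives.HodgeStructureK3TypeAdjointProofs
import Mathlib.RingTheory.TensorProduct.Free
import HarnessLib

/-!
# `S(H¹(X, ℚ))(ℂ)` IS `S(X)(ℂ)`: the Lefschetz group of the weight-one Hodge structure `H¹(X, ℚ)` of a complex torus,
# on complex points, in lattice coordinates — the carrier bridge for the groups (Milne 1999 §1, §4; Lange 2023 §7.2.4 Ex. (4))

[topic Geometry/Kaehler]

Layer `Literature/Geometry/Kaehler`, namespace `Literature.Geometry.Kaehler.ComplexTorus`; lane `lit-hodgefound`
(Track 2 foundations library), Layer A4 (cycle classes on abelian varieties · Hodge classes · Lefschetz groups),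
SKELETON row **A4-99** (skeleton seat `lit-hodgefound-skel-4`, generation 40; the «carrier bridge», part 2a).
Two DEFINITIONS WITH BODIES (`coordOneFormBasisC`, `hOneMatrix`) and PROVED theorems; no instance, no named fact
(D-0026, net debt `0`).  Everything else is consumed BY NAME.

## The point of this file

The tree carries the Lefschetz group of a complex torus / abelian variety `X = E/Φ(ℤ^ι)` on TWO carriers:

* TORUS (matrices, lattice = homology coordinates `V = H₁(X, ℚ) = ℚ^ι`): `lefschetzGroupC Φ G ≤ SL_ι(ℂ)`, cut out by
  `ᵗM G M = G` (`G` the rational Gram matrix of a polarisation on the lattice basis) and `M A = A M` for all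
  `A ∈ endAlgRat Φ = End_ℚ(X)` (`ComplexTorusLefschetzGroupIdentityComponent`, `mem_lefschetzGroupC_iff`);
* ABSTRACT (the weight-one `ℚ`-Hodge structure `H¹(X, ℚ) = hodgeStructure Φ 1` on `rationalForms Φ 1`):
  `Q.lefschetzGroupBaseChange ℂ ≤ GL(ℂ ⊗_ℚ H¹(X, ℚ))` for a polarization `Q` of `H¹(X, ℚ)` — the `γ` commuting with
  `End_HS(H¹(X, ℚ)) ⊗ ℂ` and preserving `Q_ℂ` (`Motives/HodgeStructureLefschetzGroupPoints`).

This file identifies them: an automorphism `γ` of `ℂ ⊗ H¹(X, ℚ)` is the pull-back of one-forms along a unique complex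
matrix `M = hOneMatrix Φ γ` acting on `H₁(X, ℂ) = ℂ^ι` (`γ(1 ⊗ dxₐ) = Σ_b M_{ab} (1 ⊗ dx_b)`, i.e. `M` is the TRANSPOSE of
the matrix of `γ` in the basis `1 ⊗ dxₐ`), and **`γ ∈ S_Q(H¹(X, ℚ))(ℂ)` iff `M ∈ S(X)(ℂ)`**, for EVERY polarization `Q` of
`H¹(X, ℚ)` and EVERY polarisation `E` of `X` («`S(A)` … for any ample divisor `D`» — it depends on neither).  On the way:
the dictionary `End_HS(H¹(X, ℚ)) = {B^* | B ∈ End_ℚ(X)}` in matrices (`hOneMatrix (B^* ⊗ ℂ) = B`), the Deligne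
torus `h(e^{iθ})` of `H¹(X, ℚ)` IS the pull-back along Lange's `h(e^{iθ}) = cos θ · 1 + sin θ · J`
(`hOneMatrix (h(e^{iθ})) = hodgeCircle Φ θ`; at `θ = π/2`: the Weil operator is `J`), the Gram matrix `[Q]` of a
polarization of `H¹(X, ℚ)` on the basis `dxₐ` is skew, non-degenerate and `J`-invariant (`J [Q] ᵗJ = [Q]`), and
`[Q] · G ∈ End_ℚ(X)` (Lange's `φ_{E₀}⁻¹ φ_E ∈ End_ℚ(X)` of Exercise 7.2.4 (4)(a), read with one form on homology and one
on cohomology) — which is what makes the polarisations on the two carriers interchangeable.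

## Sources, verbatim (held texts, re-read this session)

* J. S. Milne, *Lefschetz classes on abelian varieties*, Duke Math. J. **96** (1999) 639–675 [Milne1999LefschetzClasses]
  (held `paper:doi-10-1215-s0012-7094-99-09620-5`), §1 p. 644 L16–L20: «`S(A)(R) = {γ ∈ C(A) ⊗_k R | γ†γ = 1}`. Thus, for any
  ample divisor `D` on `A`, `S(A)` is the largest algebraic subgroup of `Sp(e_D)` whose elements commute with the endomorphisms
  of `A`»; §4 p. 660: «`Hg′(A) = S(A)`» read on `H¹(A)`.
* H. Lange, *Abelian Varieties over the Complex Numbers* (Springer 2023) [Lange2023AbelianVarietiesComplex], §7.2.4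
  Exercise (4) (p. 334): «`Lf(X) := {g ∈ Sp(W, E) | g ∘ φ = φ ∘ g for all φ ∈ End_ℚ(X)}⁰` … (a) `Lf(X)` does not depend on
  the polarization (use `φ_{E₀}⁻¹ φ_E ∈ End_ℚ(X)`)»; §7.1.1 Prop. 7.1.1 («`h(z) = cos θ · 1_V + sin θ · J`», «`J = h(i)`»);
  §7.2.2 p. 331: «Consider `H¹(X, ℚ) = V^*` as the dual representation»; §1.1.3 Lemma 1.1.17 («`H¹(X, ℤ) = Hom(Λ, ℤ)`»,
  the basis `dxₐ`); §1.2.2 Lemma 1.2.10 (`ᵗJ G J = G` for a form of type `(1,1)`).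
* P. Deligne, *Hodge cycles on abelian varieties*, LNM 900 (1982) [Deligne1982HodgeCycles], I §3 proof of Prop. 3.6:
  «write `C = h(i)` … `ψ(Cx, Cy) = ψ(x, y)` … `C ∈ G⁰(ℝ)`».
* J. Carlson, S. Müller-Stach, C. Peters, *Period Mappings and Period Domains* (2017) [CarlsonMullerStachPeters2017],
  §15.1 Lemma–Definition 15.1.1 («`S` acts as multiplication by `z^p z̄^q`» on `H^{p,q}`).
* D. McDuff, D. Salamon, *Introduction to Symplectic Topology* (2017) [McDuffSalamon2017], Thm. 2.1.3 (symplectic basis;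
  here: a complex matrix preserving a non-degenerate rational alternating form has determinant `1`).

## Dictionary and what is proved

`X = ComplexTorus Φ`, `H¹ = hodgeStructure Φ 1` on `V = rationalForms Φ 1` with basis `dxₐ = coordOneFormBasis Φ a`,
`Θ = complexification Φ 1 : ℂ ⊗ V ≅ H¹(X, ℂ)`, `J = jMatrix Φ`, `End_ℚ(X) = endAlgRat Φ`, `B^* = pullbackFormsRat Φ Φ B 1`.

* §1 `coordOneFormBasisC Φ` (the `ℂ`-basis `1 ⊗ dxₐ` of `ℂ ⊗ H¹(X, ℚ)`), **`hOneMatrix Φ γ`** (the complex `ι × ι` matrix `M`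
  with `γ(1 ⊗ dxₐ) = Σ_b M_{ab} (1 ⊗ dx_b)`): `apply_coordOneFormBasisC`, anti-multiplicativity `hOneMatrix_mul`,
  `hOneMatrix_one`, `hOneMatrix_injective`, `isUnit_det_hOneMatrix`, `hOneMatrix_baseChange`
  (`= homMatrix`, complexified), **`hOneMatrix_baseChange_pullbackFormsRat : hOneMatrix (B^* ⊗ ℂ) = B`**,
  `hOneMatrix_eq_map_of_forall_complexification_eq` (a real matrix `M` with `Θ ∘ γ = ρ(M)^* ∘ Θ` is `hOneMatrix γ`),
  `hOneMatrix_toLinearEquiv'` (every invertible matrix is a `hOneMatrix`).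
* §2 THE ENDOMORPHISMS: `forall_endAlg_comm_iff_forall_endAlgRat_comm` — `γ` commutes with `a_ℂ` for all `a ∈ End_HS(H¹)` iff
  `hOneMatrix γ` commutes with `A_ℂ` for all `A ∈ End_ℚ(X)` (`End_HS(H¹(X, ℚ)) = {B^*}`, the tree's
  `mem_endAlg_hodgeStructure_one_iff`).
* §3 THE DELIGNE TORUS: **`complexification_hodgeTorus_apply`** (`Θ(h(e^{iθ}) x) = (Θ x) ∘ ρ(hodgeCircle Φ θ)`, all degrees
  `k`), **`hOneMatrix_hodgeTorus`** (`= hodgeCircle Φ θ ⊗ ℂ`), `hOneMatrix_weilOperator` (`C = h(i)` is `J`).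
* §4 THE FORM: for a polarization `Q` of `H¹(X, ℚ)` with Gram matrix `[Q] = LinearMap.BilinForm.toMatrix (coordOneFormBasis Φ) Q.form`:
  `forall_form_baseChange_eq_iff` (`γ` preserves `Q_ℂ` iff `M [Q]_ℂ ᵗM = [Q]_ℂ`, `M = hOneMatrix γ`), `polarizationMatrix_transpose`
  (skew), `isUnit_det_polarizationMatrix`, **`jMatrix_mul_polarizationMatrix_mul_transpose`** (`J [Q] ᵗJ = [Q]`, from
  `Q(Cx, Cy) = Q(x, y)` and §3), **`polarizationMatrix_mul_mem_endAlgRat`** (`[Q] G ∈ End_ℚ(X)` for the rational Gram matrix `G`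
  of any `η` of type `(1,1)`), `det_eq_one_of_mul_mul_transpose_eq` (`M G ᵗM = G`, `G` rational skew non-degenerate ⟹ `det M = 1`, from the tree's
  `det_eq_one_of_transpose_mul_mul_eq`).
* §5 THE LEFSCHETZ GROUP: **`mem_lefschetzGroupBaseChange_iff_hOneMatrix`** — for `η` of type `(1,1)` with rational
  non-degenerate Gram matrix `G` (every polarisation of `X`: `IsRiemannForm.mem_lefschetzGroupBaseChange_iff_hOneMatrix`) and
  every polarization `Q` of `H¹(X, ℚ)`: `γ ∈ S_Q(H¹(X, ℚ))(ℂ) ⟺ ᵗM G M = G ∧ ∀ A ∈ End_ℚ(X), M A = A M`;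
  `det_hOneMatrix_eq_one_of_mem_lefschetzGroupBaseChange`; **`exists_mem_lefschetzGroupC_coe_eq_hOneMatrix`** (the
  element of `lefschetzGroupC Φ G`); **`exists_mem_lefschetzGroupBaseChange_hOneMatrix_eq`** (every `M ∈ S(X)(ℂ)` arises: the
  correspondence is ONTO `lefschetzGroupC Φ G`).

NOT here (the sequel, part 2b): the Hodge group `hodgeGroupC Φ` versus `hodgeGroupBaseChange ℂ` under the same dictionary, and
the assembly «stably nondegenerate ⟺ `Hg(X)(ℂ) = S(X)(ℂ)`» with `ComplexTorusStablyNondegenerateIffFirstCohomologyHodgeGroup`.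

## References

* [Milne1999LefschetzClasses] J. S. Milne, *Lefschetz classes on abelian varieties*, Duke Math. J. 96 (1999): §1 p. 644, §4 p. 660.
* [Lange2023AbelianVarietiesComplex] H. Lange, *Abelian Varieties over the Complex Numbers* (2023): §7.2.4 Exercise (4),
  §7.1.1 Prop. 7.1.1, §7.2.2 (p. 331), §1.1.3 Lemma 1.1.17, §1.2.2 Lemma 1.2.10.
* [Deligne1982HodgeCycles] P. Deligne, *Hodge cycles on abelian varieties*, LNM 900 (1982): I §3, proof of Prop. 3.6.
* [CarlsonMullerStachPeters2017] J. Carlson, S. Müller-Stach, C. Peters, *Period Mappings and Period Domains*, 2nd ed. (2017):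
  §15.1 Lemma–Definition 15.1.1.
* [McDuffSalamon2017] D. McDuff, D. Salamon, *Introduction to Symplectic Topology*, 3rd ed. (2017): Thm. 2.1.3.

## Provenance

Lane `lit-hodgefound`, seat skel-4 (generation 40), row A4-99; consumes BY NAME `coordOneFormBasis` (`ComplexTorusDualHodgeStructure`),
`homMatrix` / `pullbackFormsRat` / `eq_sum_oneFormPeriod_smul_coordOneForm` / `homMatrix_pullbackFormsRat`
(`ComplexTorusHodgeStructureHomomorphisms`), `mem_endAlg_hodgeStructure_one_iff` (`ComplexTorusCorrespondenceRingHodgeEndomorphisms`),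
`hodgeCircle` / `jMatrix` / `mem_endAlgRat_iff` / `transpose_jMatrix_mul_latticeGram_mul_jMatrix` (`ComplexTorusHodgeGroup`,
`ComplexTorusRosati`), `mem_piece_hodgeStructure_iff` / `complexification` (`ComplexTorusRationalHodgeStructure`),
`compContinuousLinearMap_rotateCLM_of_isOfTypeAt` (`ComplexTorusCorrespondenceAction`), `sum_antidiagonal_typeProjAt`
(`ComplexTorusHodgeDecomposition`), `lefschetzGroupC` / `mem_lefschetzGroupC_iff` (`ComplexTorusLefschetzGroupIdentityComponent`),
`det_eq_one_of_transpose_mul_mul_eq` (`ComplexTorusLefschetzGroupProductIdentityComponent`), and on the abstract side `Polarization.lefschetzGroupBaseChange` /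
`Polarization.mem_lefschetzGroupBaseChange_iff` (`Motives/HodgeStructureLefschetzGroupPoints`), `hodgeTorus_apply_of_mem_piece` /
`weilOperator_eq_hodgeTorus_I` / `weilOperator_mem_hodgeGroupBaseChange` (`Motives/HodgeStructureDeligneTorus(MumfordTate)`),
`Polarization.nondegenerate` (`Motives/HodgeStructureK3TypeAdjointProofs`).
-/

noncomputable section

-- Nested instance problems on the carrier `↥(rationalForms Φ 1)` (cf. `ComplexTorusSigmaPiFirstCohomology`).
set_option maxSynthPendingDepth 3

open scoped TensorProduct Matrix
open Module Function Complex Matrix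
open Literature.AlgebraicGeometry.Motives (HodgeStructure)
open Literature.Analysis.Complex (IsOfTypeAt typeProjAt isOfTypeAt_typeProjAt rotateCLM rotateCLM_apply
  mem_typeSubmodule_iff_isOfTypeAt sum_antidiagonal_typeProjAt)
open Finset.HasAntidiagonal (antidiagonal mem_antidiagonal)

namespace Literature.Geometry.Kaehler

namespace ComplexTorus

/-! ## §1 The basis `1 ⊗ dxₐ` of `ℂ ⊗ H¹(X, ℚ)` and the matrix `hOneMatrix γ` on `H₁(X, ℂ)` of an endomorphism `γ` -/

section PullbackMatrix

variable {ι : Type*} [Fintype ι] [DecidableEq ι] {E : Type*} [NormedAddCommGroup E] [NormedSpace ℂ E]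
  (Φ : (ι → ℝ) ≃L[ℝ] E)

/-- The `ℂ`-basis `(1 ⊗ dxₐ)ₐ` of `ℂ ⊗_ℚ H¹(X, ℚ)` (base change of the basis `dxₐ` of `H¹(X, ℚ) = Hom(Λ, ℚ)` dual to the lattice
basis). [cite: Lange2023AbelianVarietiesComplex, §1.1.3 Lemma 1.1.17] -/
def coordOneFormBasisC : Basis ι ℂ (ℂ ⊗[ℚ] rationalForms Φ 1) :=
  Algebra.TensorProduct.basis ℂ (coordOneFormBasis Φ)

/-- `coordOneFormBasisC Φ a = 1 ⊗ dxₐ`. [cite: Lange2023AbelianVarietiesComplex, §1.1.3 Lemma 1.1.17] -/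
@[simp]
theorem coordOneFormBasisC_apply (a : ι) : coordOneFormBasisC Φ a = (1 : ℂ) ⊗ₜ[ℚ] coordOneForm Φ a := by
  rw [coordOneFormBasisC, Algebra.TensorProduct.basis_apply, coordOneFormBasis_apply]

/-- `Θ(1 ⊗ dxₐ) = dxₐ` in `H¹(X, ℂ)`. [cite: Lange2023AbelianVarietiesComplex, §1.1.3 Cor. 1.1.19] -/
theorem complexification_coordOneFormBasisC (a : ι) :
    complexification Φ 1 (coordOneFormBasisC Φ a) = (coordOneForm Φ a : E [⋀^Fin 1]→L[ℝ] ℂ) := by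
  rw [coordOneFormBasisC_apply, complexification_tmul, one_smul]

/-- **The matrix on `H₁(X, ℂ) = ℂ^ι` of which `γ ∈ End_ℂ(ℂ ⊗ H¹(X, ℚ))` is the pull-back**: the TRANSPOSE of the matrix of `γ`
in the basis `1 ⊗ dxₐ` — `γ(1 ⊗ dxₐ) = Σ_b (hOneMatrix Φ γ)_{ab} (1 ⊗ dx_b)`, exactly as `M^*(dxₐ) = dxₐ ∘ M = Σ_b M_{ab} dx_b`
(«consider `H¹(X, ℚ) = V^*` as the dual representation»). [cite: Lange2023AbelianVarietiesComplex, §7.2.2 (p. 331) and §1.1.3 Lemma 1.1.17 (a)] -/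
def hOneMatrix (γ : (ℂ ⊗[ℚ] rationalForms Φ 1) →ₗ[ℂ] (ℂ ⊗[ℚ] rationalForms Φ 1)) : Matrix ι ι ℂ :=
  (LinearMap.toMatrix (coordOneFormBasisC Φ) (coordOneFormBasisC Φ) γ)ᵀ

/-- The entries: `(hOneMatrix γ)_{ab}` is the `b`-th coordinate of `γ(1 ⊗ dxₐ)`. [cite: Lange2023AbelianVarietiesComplex, §1.1.3 Lemma 1.1.17 (a)] -/
theorem hOneMatrix_apply (γ : (ℂ ⊗[ℚ] rationalForms Φ 1) →ₗ[ℂ] (ℂ ⊗[ℚ] rationalForms Φ 1)) (a b : ι) :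
    hOneMatrix Φ γ a b = (coordOneFormBasisC Φ).repr (γ (coordOneFormBasisC Φ a)) b := by
  rw [hOneMatrix, transpose_apply, LinearMap.toMatrix_apply]

/-- `hOneMatrix γ` is the transpose of the matrix of `γ`. [cite: Lange2023AbelianVarietiesComplex, §7.2.2 (p. 331: the dual representation)] -/
theorem transpose_hOneMatrix (γ : (ℂ ⊗[ℚ] rationalForms Φ 1) →ₗ[ℂ] (ℂ ⊗[ℚ] rationalForms Φ 1)) :
    (hOneMatrix Φ γ)ᵀ = LinearMap.toMatrix (coordOneFormBasisC Φ) (coordOneFormBasisC Φ) γ :=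
  transpose_transpose _

/-- **`γ(1 ⊗ dxₐ) = Σ_b M_{ab} (1 ⊗ dx_b)`**, `M = hOneMatrix γ`. [cite: Lange2023AbelianVarietiesComplex, §1.1.3 Lemma 1.1.17 (a)] -/
theorem apply_coordOneFormBasisC (γ : (ℂ ⊗[ℚ] rationalForms Φ 1) →ₗ[ℂ] (ℂ ⊗[ℚ] rationalForms Φ 1)) (a : ι) :
    γ (coordOneFormBasisC Φ a) = ∑ b, hOneMatrix Φ γ a b • coordOneFormBasisC Φ b := by
  conv_lhs => rw [← (coordOneFormBasisC Φ).sum_repr (γ (coordOneFormBasisC Φ a))]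
  simp_rw [hOneMatrix_apply]

/-- A linear map with `γ(1 ⊗ dxₐ) = Σ_b M_{ab} (1 ⊗ dx_b)` has `hOneMatrix γ = M`. [cite: Lange2023AbelianVarietiesComplex, §1.1.3 Lemma 1.1.17 (a)] -/
theorem hOneMatrix_eq_of_apply_eq {γ : (ℂ ⊗[ℚ] rationalForms Φ 1) →ₗ[ℂ] (ℂ ⊗[ℚ] rationalForms Φ 1)}
    {M : Matrix ι ι ℂ} (h : ∀ a, γ (coordOneFormBasisC Φ a) = ∑ b, M a b • coordOneFormBasisC Φ b) :
    hOneMatrix Φ γ = M := by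
  ext a b
  rw [hOneMatrix_apply, h a, (coordOneFormBasisC Φ).repr_sum_self]

/-- `hOneMatrix` is ANTI-multiplicative: `hOneMatrix (γ ∘ γ′) = hOneMatrix γ′ · hOneMatrix γ` — as
`(M M′)^* = M′^* M^*`. [cite: Lange2023AbelianVarietiesComplex, §1.1.2 p. 20 («`ρ_r(f′f) = ρ_r(f′)ρ_r(f)`», dualised)] -/
theorem hOneMatrix_comp (γ γ' : (ℂ ⊗[ℚ] rationalForms Φ 1) →ₗ[ℂ] (ℂ ⊗[ℚ] rationalForms Φ 1)) :
    hOneMatrix Φ (γ ∘ₗ γ') = hOneMatrix Φ γ' * hOneMatrix Φ γ := by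
  rw [hOneMatrix, LinearMap.toMatrix_comp (coordOneFormBasisC Φ) (coordOneFormBasisC Φ) (coordOneFormBasisC Φ),
    transpose_mul, hOneMatrix, hOneMatrix]

/-- `hOneMatrix (γ * γ′) = hOneMatrix γ′ * hOneMatrix γ`. [cite: Lange2023AbelianVarietiesComplex, §1.1.2 p. 20] -/
theorem hOneMatrix_mul (γ γ' : (ℂ ⊗[ℚ] rationalForms Φ 1) →ₗ[ℂ] (ℂ ⊗[ℚ] rationalForms Φ 1)) :
    hOneMatrix Φ (γ * γ') = hOneMatrix Φ γ' * hOneMatrix Φ γ :=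
  hOneMatrix_comp Φ γ γ'

/-- `hOneMatrix 1 = 1`. [cite: Lange2023AbelianVarietiesComplex, §1.1.2 p. 20] -/
@[simp]
theorem hOneMatrix_one : hOneMatrix Φ (1 : (ℂ ⊗[ℚ] rationalForms Φ 1) →ₗ[ℂ] (ℂ ⊗[ℚ] rationalForms Φ 1)) = 1 := by
  rw [hOneMatrix, Module.End.one_eq_id, LinearMap.toMatrix_id, transpose_one]

/-- `hOneMatrix id = 1`. [cite: Lange2023AbelianVarietiesComplex, §1.1.2 p. 20] -/
@[simp]
theorem hOneMatrix_id : hOneMatrix Φ (LinearMap.id : (ℂ ⊗[ℚ] rationalForms Φ 1) →ₗ[ℂ] _) = 1 := by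
  rw [hOneMatrix, LinearMap.toMatrix_id, transpose_one]

/-- `γ ↦ hOneMatrix γ` is injective («the representations `ρ_a` and `ρ_r` are injective»). [cite: Lange2023AbelianVarietiesComplex, §1.1.2 Prop. 1.1.6] -/
theorem hOneMatrix_injective :
    Injective (hOneMatrix Φ : ((ℂ ⊗[ℚ] rationalForms Φ 1) →ₗ[ℂ] (ℂ ⊗[ℚ] rationalForms Φ 1)) → Matrix ι ι ℂ) := by
  intro γ γ' h
  have h' := congrArg Matrix.transpose h
  rw [transpose_hOneMatrix, transpose_hOneMatrix] at h'
  exact (LinearMap.toMatrix (coordOneFormBasisC Φ) (coordOneFormBasisC Φ)).injective h'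

/-- `det (hOneMatrix γ) = det γ`. [cite: Lange2023AbelianVarietiesComplex, §1.1.2 p. 20] -/
theorem det_hOneMatrix (γ : (ℂ ⊗[ℚ] rationalForms Φ 1) →ₗ[ℂ] (ℂ ⊗[ℚ] rationalForms Φ 1)) :
    (hOneMatrix Φ γ).det = LinearMap.det γ := by
  rw [hOneMatrix, det_transpose, LinearMap.det_toMatrix]

/-- For an AUTOMORPHISM `γ` the matrix `hOneMatrix γ` is invertible. [cite: Lange2023AbelianVarietiesComplex, §1.1.2 p. 20] -/
theorem isUnit_det_hOneMatrix (γ : (ℂ ⊗[ℚ] rationalForms Φ 1) ≃ₗ[ℂ] (ℂ ⊗[ℚ] rationalForms Φ 1)) :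
    IsUnit (hOneMatrix Φ γ.toLinearMap).det := by
  rw [det_hOneMatrix]
  exact γ.isUnit_det'

/-- `hOneMatrix γ⁻¹ = (hOneMatrix γ)⁻¹` for an automorphism `γ`. [cite: Lange2023AbelianVarietiesComplex, §1.1.2 p. 20] -/
theorem hOneMatrix_symm (γ : (ℂ ⊗[ℚ] rationalForms Φ 1) ≃ₗ[ℂ] (ℂ ⊗[ℚ] rationalForms Φ 1)) :
    hOneMatrix Φ γ.symm.toLinearMap = (hOneMatrix Φ γ.toLinearMap)⁻¹ := by
  have hprod : hOneMatrix Φ γ.toLinearMap *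
      hOneMatrix Φ γ.symm.toLinearMap = 1 := by
    rw [← hOneMatrix_comp, LinearEquiv.symm_comp, hOneMatrix_id]
  exact (Matrix.inv_eq_right_inv hprod).symm

/-- **`ℚ`-linear maps: `hOneMatrix (ψ ⊗ ℂ)` is the (rational) matrix `homMatrix ψ` of the tree**, complexified.
[cite: Lange2023AbelianVarietiesComplex, §1.1.3 Lemma 1.1.17 (a)] [cite: vanGeemen1994HodgeAV, 3.6 (p. 217)] -/
theorem hOneMatrix_baseChange (ψ : rationalForms Φ 1 →ₗ[ℚ] rationalForms Φ 1) :
    hOneMatrix Φ (ψ.baseChange ℂ) = (homMatrix Φ Φ ψ).map (algebraMap ℚ ℂ) := by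
  rw [hOneMatrix, coordOneFormBasisC, LinearMap.toMatrix_baseChange]
  ext a b
  -- the `dx`-coordinates of a class are its periods (`γ = Σₐ γ(λₐ) dxₐ`)
  have hrepr : ∀ γ : rationalForms Φ 1, (coordOneFormBasis Φ).repr γ b = oneFormPeriod Φ γ b := fun γ ↦ by
    conv_lhs => rw [eq_sum_oneFormPeriod_smul_coordOneForm Φ γ]
    simp_rw [← coordOneFormBasis_apply]
    rw [(coordOneFormBasis Φ).repr_sum_self]
  rw [transpose_apply, map_apply, map_apply, LinearMap.toMatrix_apply, coordOneFormBasis_apply, hrepr, homMatrix_apply]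

/-- **`hOneMatrix (B^* ⊗ ℂ) = B`** for every rational matrix `B` (the pull-back `B^* = pullbackFormsRat Φ Φ B 1` of one-forms
along `ρ(B)`): the dictionary is the identity on `End_ℚ(X) ⊆ M_ι(ℚ)`. [cite: Lange2023AbelianVarietiesComplex, §1.1.3 Lemma 1.1.17 (a) and §7.2.2 (p. 331)] -/
theorem hOneMatrix_baseChange_pullbackFormsRat (B : Matrix ι ι ℚ) :
    hOneMatrix Φ ((pullbackFormsRat Φ Φ B 1).baseChange ℂ) = B.map (algebraMap ℚ ℂ) := by
  rw [hOneMatrix_baseChange, homMatrix_pullbackFormsRat]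

omit [DecidableEq ι] in
/-- **`dxₐ ∘ ρ(M) = Σ_b M_{ab} dx_b`** for a real matrix `M` on `H₁(X, ℝ) = ℝ^ι` (`ρ(M) = Φ M Φ⁻¹`).
[cite: Lange2023AbelianVarietiesComplex, §1.1.4 Prop. 1.1.20 and §7.2.2 (p. 331: `⋀ M^*`)] -/
theorem coordOneForm_compContinuousLinearMap_analyticRepReal (M : Matrix ι ι ℝ) (a : ι) :
    (coordOneForm Φ a : E [⋀^Fin 1]→L[ℝ] ℂ).compContinuousLinearMap (analyticRepReal Φ Φ M) =
      ∑ b, ((M a b : ℝ) : ℂ) • (coordOneForm Φ b : E [⋀^Fin 1]→L[ℝ] ℂ) := by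
  ext v
  rw [ContinuousAlternatingMap.compContinuousLinearMap_apply, coordOneForm_apply, ContinuousAlternatingMap.sum_apply]
  simp only [Function.comp_apply, analyticRepReal_apply', coord_apply, ContinuousLinearEquiv.symm_apply_apply,
    ContinuousAlternatingMap.smul_apply, coordOneForm_apply, smul_eq_mul, Matrix.mulVec, dotProduct, Complex.ofReal_sum,
    Complex.ofReal_mul]

/-- **A real matrix `M` with `Θ(γ x) = (Θ x) ∘ ρ(M)` for all `x` IS `hOneMatrix γ`** (complexified): the dictionary recovers
the tree's real pull-back of forms. [cite: Lange2023AbelianVarietiesComplex, §7.2.2 (p. 331: `H¹(X, ℚ) = V^*` as the dual representation)] -/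
theorem hOneMatrix_eq_map_of_forall_complexification_eq {γ : (ℂ ⊗[ℚ] rationalForms Φ 1) →ₗ[ℂ] (ℂ ⊗[ℚ] rationalForms Φ 1)}
    {M : Matrix ι ι ℝ}
    (h : ∀ x, complexification Φ 1 (γ x) = (complexification Φ 1 x).compContinuousLinearMap (analyticRepReal Φ Φ M)) :
    hOneMatrix Φ γ = M.map Complex.ofRealHom := by
  refine hOneMatrix_eq_of_apply_eq Φ fun a ↦ (complexification Φ 1).injective ?_
  rw [h, complexification_coordOneFormBasisC, coordOneForm_compContinuousLinearMap_analyticRepReal, map_sum]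
  refine Finset.sum_congr rfl fun b _ ↦ ?_
  rw [map_smul, complexification_coordOneFormBasisC, map_apply, Complex.ofRealHom_eq_coe]

/-- **Every invertible complex matrix is a `hOneMatrix`**: the automorphism `Matrix.toLinearEquiv` of `ᵗM` in the basis
`1 ⊗ dxₐ` has `hOneMatrix = M`. [cite: Lange2023AbelianVarietiesComplex, §7.2.2 (p. 331)] -/
theorem hOneMatrix_toLinearEquiv' {M : Matrix ι ι ℂ} (hM : IsUnit Mᵀ.det) :
    hOneMatrix Φ (Matrix.toLinearEquiv (coordOneFormBasisC Φ) Mᵀ hM).toLinearMap = M := by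
  rw [hOneMatrix]
  conv_rhs => rw [← transpose_transpose M]
  congr 1
  refine (Matrix.toLin (coordOneFormBasisC Φ) (coordOneFormBasisC Φ)).injective ?_
  rw [Matrix.toLin_toMatrix]
  rfl

end PullbackMatrix

/-! ## §2 The endomorphisms: `End_HS(H¹(X, ℚ)) ⊗ ℂ` versus `End_ℚ(X) ⊗ ℂ` -/

section Endomorphisms

variable {ι : Type*} [Fintype ι] [DecidableEq ι] {E : Type*} [NormedAddCommGroup E] [NormedSpace ℂ E]
  (Φ : (ι → ℝ) ≃L[ℝ] E)

/-- Commuting with a base-changed endomorphism, in matrices: `γ ∘ (ψ ⊗ ℂ) = (ψ ⊗ ℂ) ∘ γ` iff `hOneMatrix γ` commutes with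
`homMatrix ψ`. [cite: Milne1999LefschetzClasses, §1 p. 644 L18–L20 («whose elements commute with the endomorphisms»)] -/
theorem comp_baseChange_eq_iff_hOneMatrix_comm (γ : (ℂ ⊗[ℚ] rationalForms Φ 1) →ₗ[ℂ] (ℂ ⊗[ℚ] rationalForms Φ 1))
    (ψ : rationalForms Φ 1 →ₗ[ℚ] rationalForms Φ 1) :
    (∀ x, ψ.baseChange ℂ (γ x) = γ (ψ.baseChange ℂ x)) ↔
      hOneMatrix Φ γ * (homMatrix Φ Φ ψ).map (algebraMap ℚ ℂ) =
        (homMatrix Φ Φ ψ).map (algebraMap ℚ ℂ) * hOneMatrix Φ γ := by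
  rw [← hOneMatrix_baseChange, ← hOneMatrix_comp, ← hOneMatrix_comp, (hOneMatrix_injective Φ).eq_iff]
  constructor
  · intro h
    exact LinearMap.ext fun x ↦ h x
  · intro h x
    exact LinearMap.congr_fun h x

/-- **THE ENDOMORPHISM DICTIONARY**: `γ` commutes with `a ⊗ ℂ` for every `a ∈ End_HS(H¹(X, ℚ))` iff `hOneMatrix γ` commutes
with `A ⊗ ℂ` for every `A ∈ End_ℚ(X)` — because `End_HS(H¹(X, ℚ)) = {B^* | B ∈ End_ℚ(X)}` (the tree's
`mem_endAlg_hodgeStructure_one_iff`) and `hOneMatrix (B^* ⊗ ℂ) = B`. [cite: Milne1999LefschetzClasses, §1 p. 644 L18–L20]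
[cite: vanGeemen1994HodgeAV, 3.6 (p. 217: «`φ^*` is a morphism of Hodge structures»)] [cite: Lange2023AbelianVarietiesComplex, §7.2.4 Exercise (4)] -/
theorem forall_endAlg_comm_iff_forall_endAlgRat_comm (γ : (ℂ ⊗[ℚ] rationalForms Φ 1) →ₗ[ℂ] (ℂ ⊗[ℚ] rationalForms Φ 1)) :
    (∀ a : (hodgeStructure Φ 1).endAlg, ∀ x,
        (a : Module.End ℚ (rationalForms Φ 1)).baseChange ℂ (γ x) = γ ((a : Module.End ℚ (rationalForms Φ 1)).baseChange ℂ x)) ↔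
      ∀ A ∈ endAlgRat Φ, hOneMatrix Φ γ * A.map (algebraMap ℚ ℂ) = A.map (algebraMap ℚ ℂ) * hOneMatrix Φ γ := by
  constructor
  · intro h A hA
    have ha : pullbackFormsRat Φ Φ A 1 ∈ (hodgeStructure Φ 1).endAlg :=
      (CorrRing.mem_endAlg_hodgeStructure_one_iff Φ _).2 ⟨A, hA, rfl⟩
    have h' := (comp_baseChange_eq_iff_hOneMatrix_comm Φ γ (pullbackFormsRat Φ Φ A 1)).1 (h ⟨_, ha⟩)
    rwa [homMatrix_pullbackFormsRat] at h'
  · intro h a x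
    obtain ⟨B, hB, hab⟩ := (CorrRing.mem_endAlg_hodgeStructure_one_iff Φ _).1 a.2
    have h' : hOneMatrix Φ γ * (homMatrix Φ Φ (a : Module.End ℚ (rationalForms Φ 1))).map (algebraMap ℚ ℂ) =
        (homMatrix Φ Φ (a : Module.End ℚ (rationalForms Φ 1))).map (algebraMap ℚ ℂ) * hOneMatrix Φ γ := by
      rw [hab, homMatrix_pullbackFormsRat]
      exact h B hB
    exact (comp_baseChange_eq_iff_hOneMatrix_comm Φ γ _).2 h' x

end Endomorphisms

/-! ## §3 The Deligne torus of `H¹(X, ℚ)` is the pull-back along Lange's `h(e^{iθ}) = cos θ · 1 + sin θ · J` -/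

section DeligneTorus

variable {ι : Type*} [Fintype ι] [DecidableEq ι] {E : Type*} [NormedAddCommGroup E] [NormedSpace ℂ E]
  (Φ : (ι → ℝ) ≃L[ℝ] E)

/-- On a form of type `(p, q)`: `h(e^{iθ})^* y = e^{i(p-q)θ} y`. [cite: Lange2023AbelianVarietiesComplex, §7.2.2 Thm. 7.2.4 (proof: «`h^*(z)` acts on `H^{r,s}` by `z^r z̄^s`»)] -/
theorem compContinuousLinearMap_analyticRepReal_hodgeCircle_of_isOfTypeAt' {k p q : ℕ} {y : E [⋀^Fin k]→L[ℝ] ℂ}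
    (hy : IsOfTypeAt p q y) (θ : ℝ) :
    y.compContinuousLinearMap (analyticRepReal Φ Φ (hodgeCircle Φ θ)) = cexp ((((p : ℤ) - q : ℤ) : ℂ) * θ * I) • y := by
  rw [show analyticRepReal Φ Φ (hodgeCircle Φ θ) = rotateCLM θ from
    ContinuousLinearMap.ext fun v ↦ by rw [analyticRepReal_hodgeCircle_apply, rotateCLM_apply]]
  exact compContinuousLinearMap_rotateCLM_of_isOfTypeAt hy θ

/-- `z^p z̄^q = e^{i(p-q)θ}` for `z = e^{iθ}`. [cite: CarlsonMullerStachPeters2017, §15.1 Lemma–Definition 15.1.1] -/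
private theorem zpow_mul_conj_zpow_of_eq_cexp {z : ℂ} {θ : ℝ} (hz : z = cexp (θ * I)) (p q : ℕ) :
    z ^ (p : ℤ) * (starRingEnd ℂ z) ^ (q : ℤ) = cexp ((((p : ℤ) - q : ℤ) : ℂ) * θ * I) := by
  rw [hz, ← Complex.exp_conj, map_mul, Complex.conj_ofReal, Complex.conj_I, mul_neg, zpow_natCast, zpow_natCast,
    ← Complex.exp_nat_mul, ← Complex.exp_nat_mul, ← Complex.exp_add]
  congr 1
  push_cast
  ring

/-- **THE DELIGNE TORUS OF `Hᵏ(X, ℚ)` IS THE PULL-BACK ALONG `h(e^{iθ})`**: for `z = e^{iθ} ∈ S¹` and every `x ∈ ℂ ⊗ Hᵏ(X, ℚ)`,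
`Θ(h(z) x) = (Θ x) ∘ ρ(hodgeCircle Φ θ)` — `h(z)` acts on `V^{p,q}` by `z^p z̄^q = e^{i(p-q)θ}` («`S` acts as multiplication by
`z^p z̄^q`» on `H^{p,q}`) and so does `h(e^{iθ})^* = (cos θ · 1 + sin θ · J)^*` («`h^*(z)` acts on `H^{r,s}(X)` by multiplication
with `z^r z̄^s`»); both sides are `ℂ`-linear and `H^k(X, ℂ) = ⊕ H^{p,q}`. [cite: CarlsonMullerStachPeters2017, §15.1 Lemma–Definition 15.1.1]
[cite: Lange2023AbelianVarietiesComplex, §7.1.1 Prop. 7.1.1 and §7.2.2 Thm. 7.2.4 (proof)] -/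
theorem complexification_hodgeTorus_apply (k : ℕ) {z : ℂˣ} {θ : ℝ} (hz : (z : ℂ) = cexp (θ * I))
    (x : ℂ ⊗[ℚ] rationalForms Φ k) :
    complexification Φ k ((hodgeStructure Φ k).hodgeTorus z x) =
      (complexification Φ k x).compContinuousLinearMap (analyticRepReal Φ Φ (hodgeCircle Φ θ)) := by
  set Θ := complexification Φ k with hΘ
  set T : (ℂ ⊗[ℚ] rationalForms Φ k) →ₗ[ℂ] (ℂ ⊗[ℚ] rationalForms Φ k) :=
    ((hodgeStructure Φ k).hodgeTorus z : (ℂ ⊗[ℚ] rationalForms Φ k) ≃ₗ[ℂ] _).toLinearMap with hT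
  -- the statement for a form `y = Θ x` of pure type `(p, q)`
  have key : ∀ {p q : ℕ}, p + q = k → ∀ y : E [⋀^Fin k]→L[ℝ] ℂ, IsOfTypeAt p q y →
      Θ (T (Θ.symm y)) = y.compContinuousLinearMap (analyticRepReal Φ Φ (hodgeCircle Φ θ)) := by
    intro p q hpq y hy
    have hmem : Θ.symm y ∈ (hodgeStructure Φ k).piece p q := by
      rw [mem_piece_hodgeStructure_iff Φ k hpq, ← hΘ, LinearEquiv.apply_symm_apply]
      exact (mem_typeSubmodule_iff_isOfTypeAt hpq).2 hy
    rw [hT, LinearEquiv.coe_toLinearMap, HodgeStructure.hodgeTorus_apply_of_mem_piece _ z (by exact_mod_cast hpq) hmem,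
      map_smul,
      LinearEquiv.apply_symm_apply, compContinuousLinearMap_analyticRepReal_hodgeCircle_of_isOfTypeAt' Φ hy,
      zpow_mul_conj_zpow_of_eq_cexp hz]
  -- decompose `Θ x` into its `(p, q)`-components
  have hx : x = ∑ pq ∈ antidiagonal k, Θ.symm (typeProjAt pq.1 pq.2 (Θ x)) := by
    apply Θ.injective
    rw [map_sum]
    simp_rw [LinearEquiv.apply_symm_apply]
    exact (sum_antidiagonal_typeProjAt (Θ x)).symm
  change Θ (T x) = _
  rw [hx, map_sum, map_sum, map_sum]
  rw [show (∑ pq ∈ antidiagonal k, Θ (Θ.symm (typeProjAt pq.1 pq.2 (Θ x)))).compContinuousLinearMap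
      (analyticRepReal Φ Φ (hodgeCircle Φ θ)) = ∑ pq ∈ antidiagonal k,
        (Θ (Θ.symm (typeProjAt pq.1 pq.2 (Θ x)))).compContinuousLinearMap (analyticRepReal Φ Φ (hodgeCircle Φ θ)) from by
    ext v; simp only [ContinuousAlternatingMap.compContinuousLinearMap_apply, ContinuousAlternatingMap.sum_apply]]
  refine Finset.sum_congr rfl fun pq hpq ↦ ?_
  rw [LinearEquiv.apply_symm_apply]
  exact key (mem_antidiagonal.1 hpq) _ (isOfTypeAt_typeProjAt (mem_antidiagonal.1 hpq) _)

/-- **`hOneMatrix (h(e^{iθ})) = hodgeCircle Φ θ`** (complexified): the Deligne torus `h(S¹)` of `H¹(X, ℚ)` in the basis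
`1 ⊗ dxₐ` is (the transpose of) Lange's `h(S¹) = {cos θ · 1 + sin θ · J}` on `H₁(X, ℝ)`.
[cite: Lange2023AbelianVarietiesComplex, §7.1.1 Prop. 7.1.1 and §7.2.1 (p. 329: «`h : S¹ → SL(V_ℝ)`»)] [cite: CarlsonMullerStachPeters2017, §15.1 Lemma–Definition 15.1.1] -/
theorem hOneMatrix_hodgeTorus {z : ℂˣ} {θ : ℝ} (hz : (z : ℂ) = cexp (θ * I)) :
    hOneMatrix Φ ((hodgeStructure Φ 1).hodgeTorus z).toLinearMap = (hodgeCircle Φ θ).map Complex.ofRealHom :=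
  hOneMatrix_eq_map_of_forall_complexification_eq Φ fun x ↦ by
    rw [LinearEquiv.coe_toLinearMap, complexification_hodgeTorus_apply Φ 1 hz]

/-- **The Weil operator `C = h(i)` of `H¹(X, ℚ)` is `J`**: `hOneMatrix C = jMatrix Φ` (complexified) — «`J = h(i)`»,
«`Cx = x ∘ ρ(J)`». [cite: Lange2023AbelianVarietiesComplex, §7.1.1 Prop. 7.1.1 («`J = h(i)`»)] [cite: Deligne1982HodgeCycles, I §3 proof of Prop. 3.6 («write `C = h(i)`»)] -/
theorem hOneMatrix_weilOperator :
    hOneMatrix Φ (hodgeStructure Φ 1).weilOperator.toLinearMap = (jMatrix Φ).map Complex.ofRealHom := by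
  rw [HodgeStructure.weilOperator_eq_hodgeTorus_I, ← hodgeCircle_pi_div_two]
  refine hOneMatrix_hodgeTorus Φ ?_
  rw [Units.val_mk0, Complex.ofReal_div, Complex.ofReal_ofNat]
  exact Complex.exp_pi_div_two_mul_I.symm

end DeligneTorus

/-! ## §4 The Gram matrix `[Q]` of a polarization of `H¹(X, ℚ)`: skew, non-degenerate, `J`-invariant; `[Q] G ∈ End_ℚ(X)` -/

section Form

variable {ι : Type*} [Fintype ι] [DecidableEq ι] {E : Type*} [NormedAddCommGroup E] [NormedSpace ℂ E]
  (Φ : (ι → ℝ) ≃L[ℝ] E)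

/-- The Gram matrix of `Q_ℂ` in the basis `1 ⊗ dxₐ` is `[Q] ⊗ ℂ`. [cite: Milne1999LefschetzClasses, §1 p. 643 (proof of Prop. 1.3: `e_{D₀}` after extension of scalars)] -/
theorem toMatrix_baseChange_form (Q : LinearMap.BilinForm ℚ (rationalForms Φ 1)) :
    LinearMap.BilinForm.toMatrix (coordOneFormBasisC Φ) (Q.baseChange ℂ) =
      (LinearMap.BilinForm.toMatrix (coordOneFormBasis Φ) Q).map (algebraMap ℚ ℂ) := by
  ext a b
  rw [LinearMap.BilinForm.toMatrix_apply, map_apply, LinearMap.BilinForm.toMatrix_apply, coordOneFormBasisC_apply, coordOneFormBasisC_apply,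
    LinearMap.BilinForm.baseChange_tmul, mul_one, Algebra.smul_def, mul_one, coordOneFormBasis_apply, coordOneFormBasis_apply]

/-- **The isometry condition in matrices**: `Q_ℂ(γ x, γ y) = Q_ℂ(x, y)` for all `x, y` iff `M [Q]_ℂ ᵗM = [Q]_ℂ`, `M = hOneMatrix γ`
(`[Q]` the Gram matrix of `Q` on `dxₐ`; `ᵗ(ᵗM) [Q] ᵗM`, the matrix of `γ` being `ᵗM`). [cite: Milne1999LefschetzClasses, §1 p. 644 L16–L20 («`γ†γ = 1`»)] -/
theorem forall_form_baseChange_eq_iff (Q : LinearMap.BilinForm ℚ (rationalForms Φ 1))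
    (γ : (ℂ ⊗[ℚ] rationalForms Φ 1) →ₗ[ℂ] (ℂ ⊗[ℚ] rationalForms Φ 1)) :
    (∀ x y, Q.baseChange ℂ (γ x) (γ y) = Q.baseChange ℂ x y) ↔
      hOneMatrix Φ γ * (LinearMap.BilinForm.toMatrix (coordOneFormBasis Φ) Q).map (algebraMap ℚ ℂ) * (hOneMatrix Φ γ)ᵀ =
        (LinearMap.BilinForm.toMatrix (coordOneFormBasis Φ) Q).map (algebraMap ℚ ℂ) := by
  rw [← toMatrix_baseChange_form, hOneMatrix, transpose_transpose, ← LinearMap.BilinForm.toMatrix_comp,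
    (LinearMap.BilinForm.toMatrix (coordOneFormBasisC Φ)).injective.eq_iff]
  constructor
  · intro h
    exact LinearMap.BilinForm.ext fun x y ↦ h x y
  · intro h x y
    exact DFunLike.congr_fun (DFunLike.congr_fun h x) y

/-- **`[Q]` is skew**: the Gram matrix of a polarization of the weight-ONE Hodge structure `H¹(X, ℚ)` satisfies `ᵗ[Q] = -[Q]`
(`Q(y, x) = (-1)¹ Q(x, y)`). [cite: VoisinHodgeI2002, §7.1.2 Def. 7.7 (PDF p. 134)] -/
theorem polarizationMatrix_transpose (Q : (hodgeStructure Φ 1).Polarization) :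
    (LinearMap.BilinForm.toMatrix (coordOneFormBasis Φ) Q.form)ᵀ = -LinearMap.BilinForm.toMatrix (coordOneFormBasis Φ) Q.form := by
  ext a b
  rw [transpose_apply, Matrix.neg_apply, LinearMap.BilinForm.toMatrix_apply, LinearMap.BilinForm.toMatrix_apply]
  have h := Q.flip_form
  have h1 : (((((1 : ℕ) : ℤ)).negOnePow : ℤˣ) : ℤ) = -1 := by
    rw [Nat.cast_one, Int.negOnePow_one, Units.val_neg, Units.val_one]
  rw [h1] at h
  have h' := DFunLike.congr_fun (DFunLike.congr_fun h (coordOneFormBasis Φ a)) (coordOneFormBasis Φ b)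
  rw [LinearMap.BilinForm.flip_apply, LinearMap.smul_apply, LinearMap.smul_apply, neg_one_zsmul] at h'
  exact h'

/-- **`[Q]` is non-degenerate**: `det [Q] ≠ 0` (a polarization is a non-degenerate form, the tree's `Polarization.nondegenerate`).
[cite: VoisinHodgeI2002, §7.1.2 (PDF p. 134)] [cite: Milne1999LefschetzClasses, §1 p. 643 («`e_{D₀}` is non-degenerate»)] -/
theorem isUnit_det_polarizationMatrix (Q : (hodgeStructure Φ 1).Polarization) :
    IsUnit (LinearMap.BilinForm.toMatrix (coordOneFormBasis Φ) Q.form).det := by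
  rw [isUnit_iff_ne_zero]
  exact (LinearMap.BilinForm.nondegenerate_iff_det_ne_zero (coordOneFormBasis Φ)).1 Q.nondegenerate


/-- **A complex matrix `M` with `M G ᵗM = G` for a non-degenerate rational alternating `G` has determinant `1`** (transposed
form of the tree's `det_eq_one_of_transpose_mul_mul_eq`: a rational symplectic basis conjugates into Mathlib's `symplecticGroup`,
where `det = 1`). [cite: McDuffSalamon2017, Thm. 2.1.3] [cite: Springer1998, Exercise 2.2.9 (1)(b) («`Sp_{2n} ≤ SL_{2n}`»)] -/
theorem det_eq_one_of_mul_mul_transpose_eq {G : Matrix ι ι ℚ} (hGt : Gᵀ = -G) (hdet : G.det ≠ 0) {M : Matrix ι ι ℂ}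
    (hM : M * G.map (algebraMap ℚ ℂ) * Mᵀ = G.map (algebraMap ℚ ℂ)) : M.det = 1 := by
  rw [← det_transpose]
  exact det_eq_one_of_transpose_mul_mul_eq hGt hdet (M := Mᵀ) (by rwa [transpose_transpose])

end Form

section FormHodge

-- The abstract Hodge group `hodgeGroupBaseChange` (through which `Q(Cx, Cy) = Q(x, y)` is imported) carries the tree's
-- `[HodgeTensorFacts]` hypothesis (discharged by `hodgeTensorFacts_holds`) on universe-`0` carriers, and needs `H¹(X, ℚ)`
-- finite-dimensional as an INSTANCE (discharge: `instModuleFiniteRationalForms Φ 1`), as in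
-- `ComplexTorusStablyNondegenerateIffFirstCohomologyHodgeGroup` §5.
variable {ι : Type} [Fintype ι] [DecidableEq ι] {E : Type} [NormedAddCommGroup E] [NormedSpace ℂ E]
  (Φ : (ι → ℝ) ≃L[ℝ] E) [Literature.AlgebraicGeometry.Motives.HodgeTensorFacts.{0, 0}] [Module.Finite ℚ (rationalForms Φ 1)]

omit [Fintype ι] [DecidableEq ι] [Literature.AlgebraicGeometry.Motives.HodgeTensorFacts.{0, 0}] [Module.Finite ℚ (rationalForms Φ 1)] in
/-- A rational matrix read in `ℂ` through `ℝ`: `(N ⊗ ℝ) ⊗ ℂ = N ⊗ ℂ`. [folklore] -/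
private theorem map_ratCast_map_ofRealHom (N : Matrix ι ι ℚ) :
    (N.map (Rat.cast : ℚ → ℝ)).map Complex.ofRealHom = N.map (algebraMap ℚ ℂ) := by
  ext i j
  simp only [map_apply, Complex.ofRealHom_eq_coe, Complex.ofReal_ratCast, eq_ratCast]

omit [Fintype ι] [DecidableEq ι] [Literature.AlgebraicGeometry.Motives.HodgeTensorFacts.{0, 0}] [Module.Finite ℚ (rationalForms Φ 1)] in
/-- Complexification of real matrices is injective. [folklore] -/
private theorem matrix_map_ofRealHom_injective : Injective (fun N : Matrix ι ι ℝ ↦ N.map Complex.ofRealHom) :=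
  fun _ _ h ↦ Matrix.ext fun i j ↦ Complex.ofReal_injective (congr_fun (congr_fun h i) j)

/-- **`J [Q] ᵗJ = [Q]`**: the Gram matrix of a polarization of `H¹(X, ℚ)` is invariant under the complex structure — the matrix
form of `Q(Cx, Cy) = Q(x, y)` («`ψ(Cx, Cy) = ψ(x, y)`», `C = h(i) ∈ Hg ⊆ Aut(Q)`, the tree's `weilOperator_mem_hodgeGroupBaseChange`)
with `hOneMatrix C = J` (§3). [cite: Deligne1982HodgeCycles, I §3 proof of Prop. 3.6] [cite: Lange2023AbelianVarietiesComplex, §1.2.2 Lemma 1.2.10] -/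
theorem jMatrix_mul_polarizationMatrix_mul_transpose (Q : (hodgeStructure Φ 1).Polarization) :
    jMatrix Φ * (LinearMap.BilinForm.toMatrix (coordOneFormBasis Φ) Q.form).map (Rat.cast : ℚ → ℝ) * (jMatrix Φ)ᵀ =
      (LinearMap.BilinForm.toMatrix (coordOneFormBasis Φ) Q.form).map (Rat.cast : ℚ → ℝ) := by
  -- over `ℂ`, from the isometry `C ∈ Hg(H¹)(ℂ) ⊆ Aut(Q_ℂ)` and `hOneMatrix C = J ⊗ ℂ`
  have hC : ∀ x y, Q.form.baseChange ℂ ((hodgeStructure Φ 1).weilOperator.toLinearMap x)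
      ((hodgeStructure Φ 1).weilOperator.toLinearMap y) = Q.form.baseChange ℂ x y := fun x y ↦ by
    rw [LinearEquiv.coe_toLinearMap]
    exact Q.baseChange_form_apply_apply_of_mem_hodgeGroupBaseChange ℂ
      (HodgeStructure.weilOperator_mem_hodgeGroupBaseChange (hodgeStructure Φ 1)) x y
  have hmat := (forall_form_baseChange_eq_iff Φ Q.form _).1 hC
  rw [hOneMatrix_weilOperator] at hmat
  -- descend from `ℂ` to `ℝ` along the injective `ofRealHom`
  apply matrix_map_ofRealHom_injective
  dsimp only
  rw [Matrix.map_mul, Matrix.map_mul, Matrix.transpose_map, map_ratCast_map_ofRealHom]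
  exact hmat

omit [Fintype ι] [DecidableEq ι] [Literature.AlgebraicGeometry.Motives.HodgeTensorFacts.{0, 0}] [Module.Finite ℚ (rationalForms Φ 1)] in
/-- Entrywise cast of a product of rational matrices. [folklore] -/
private theorem map_ratCast_mul [Fintype ι] (A B : Matrix ι ι ℚ) :
    (A * B).map (Rat.cast : ℚ → ℝ) = A.map (Rat.cast : ℚ → ℝ) * B.map (Rat.cast : ℚ → ℝ) :=
  Matrix.map_mul (f := Rat.castHom ℝ)

/-- **`[Q] · G ∈ End_ℚ(X)`** for the Gram matrix `[Q]` of a polarization `Q` of `H¹(X, ℚ)` (on `dxₐ`) and the rational Gram matrix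
`G` (on the lattice basis `λₐ`) of ANY form `η` of type `(1,1)` — `ᵗJ G J = G` and `J [Q] ᵗJ = [Q]` give `([Q] G) J = J ([Q] G)`.
This is Lange's «`φ_{E₀}⁻¹ φ_E ∈ End_ℚ(X)`» with `E₀` read on cohomology. [cite: Lange2023AbelianVarietiesComplex, §7.2.4 Exercise (4)(a) and §2.4.2 Prop. 2.4.12]
[cite: Lange2023AbelianVarietiesComplex, §1.2.2 Lemma 1.2.10] -/
theorem polarizationMatrix_mul_mem_endAlgRat (Q : (hodgeStructure Φ 1).Polarization) {η : E [⋀^Fin 2]→L[ℝ] ℝ}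
    (h₁₁ : ∀ u v : E, η ![I • u, I • v] = η ![u, v]) {G : Matrix ι ι ℚ} (hG : G.map (Rat.cast : ℚ → ℝ) = latticeGram Φ η) :
    LinearMap.BilinForm.toMatrix (coordOneFormBasis Φ) Q.form * G ∈ endAlgRat Φ := by
  set S : Matrix ι ι ℝ := (LinearMap.BilinForm.toMatrix (coordOneFormBasis Φ) Q.form).map (Rat.cast : ℚ → ℝ) with hS
  set J := jMatrix Φ with hJ
  have hJJ : J * J = -1 := jMatrix_mul_jMatrix Φ
  have hGJ : latticeGram Φ η * J = -(Jᵀ * latticeGram Φ η) := latticeGram_mul_jMatrix Φ h₁₁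
  have hSJ : J * S * Jᵀ = S := jMatrix_mul_polarizationMatrix_mul_transpose Φ Q
  -- `J S = -S ᵗJ` (multiply `J S ᵗJ = S` on the right by `J`, `ᵗJ J = ... `): from `J² = -1`, `ᵗJ = -J⁻¹`... via `(ᵗJ) J = 1`?
  -- we use instead: `J S = J S ᵗJ ᵗJ⁻¹`; cleaner: `S = J S ᵗJ` ⟹ `J S ᵗJ J = S J` ⟹ and `ᵗJ J`: from `ᵗJ G J = G` one has no
  -- direct `ᵗJ J`; so we derive `J S = - S ᵗJ` from `hSJ` and `ᵗJ ᵗJ = ᵗ(J J) = -1`.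
  have hJtJt : Jᵀ * Jᵀ = -1 := by rw [← transpose_mul, hJJ, transpose_neg, transpose_one]
  have hJS : J * S = -(S * Jᵀ) := by
    calc J * S = J * S * Jᵀ * Jᵀ * (-1 : Matrix ι ι ℝ) := by
            rw [Matrix.mul_assoc (J * S), hJtJt]; simp
      _ = -(S * Jᵀ) := by rw [hSJ]; simp
  rw [mem_endAlgRat_iff, map_ratCast_mul, ← hS, hG, ← hJ]
  calc S * latticeGram Φ η * J = S * (latticeGram Φ η * J) := Matrix.mul_assoc _ _ _
    _ = -(S * Jᵀ * latticeGram Φ η) := by rw [hGJ, Matrix.mul_neg, ← Matrix.mul_assoc]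
    _ = J * S * latticeGram Φ η := by rw [hJS, Matrix.neg_mul]
    _ = J * (S * latticeGram Φ η) := Matrix.mul_assoc _ _ _

end FormHodge

/-! ## §5 The Lefschetz group: `γ ∈ S_Q(H¹(X, ℚ))(ℂ)` iff `hOneMatrix γ ∈ S(X)(ℂ)` -/

section LefschetzDet

variable {ι : Type*} [Fintype ι] [DecidableEq ι] {E : Type*} [NormedAddCommGroup E] [NormedSpace ℂ E]
  (Φ : (ι → ℝ) ≃L[ℝ] E)

/-- **An element of `S_Q(H¹(X, ℚ))(ℂ)` has `det (hOneMatrix γ) = 1`** — it preserves the non-degenerate alternating `Q_ℂ`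
(«subgroup of `Sp(e_D)`», and `Sp ≤ SL`). [cite: Milne1999LefschetzClasses, §1 p. 644 L18–L20] [cite: McDuffSalamon2017, Thm. 2.1.3] -/
theorem det_hOneMatrix_eq_one_of_mem_lefschetzGroupBaseChange (Q : (hodgeStructure Φ 1).Polarization)
    {γ : (ℂ ⊗[ℚ] rationalForms Φ 1) ≃ₗ[ℂ] (ℂ ⊗[ℚ] rationalForms Φ 1)} (hγ : γ ∈ Q.lefschetzGroupBaseChange ℂ) :
    (hOneMatrix Φ γ.toLinearMap).det = 1 := by
  have hiso := (forall_form_baseChange_eq_iff Φ Q.form γ.toLinearMap).1 fun x y ↦ by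
    rw [LinearEquiv.coe_toLinearMap]
    exact Q.baseChange_form_apply_apply_of_mem_lefschetzGroupBaseChange hγ x y
  exact det_eq_one_of_mul_mul_transpose_eq (polarizationMatrix_transpose Φ Q) (isUnit_det_polarizationMatrix Φ Q).ne_zero hiso

/-- Matrix algebra behind «`S(A)` does not depend on the ample divisor»: if `M` is invertible, commutes with `S G` and satisfies
`M S ᵗM = S` for an invertible `S`, then `ᵗM G M = G`. [cite: Lange2023AbelianVarietiesComplex, §7.2.4 Exercise (4)(a)] -/
theorem transpose_mul_mul_eq_of_comm_of_mul_mul_transpose_eq {S G M : Matrix ι ι ℂ} (hS : IsUnit S.det)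
    (hM : IsUnit M.det) (hcomm : M * (S * G) = S * G * M) (hiso : M * S * Mᵀ = S) : Mᵀ * G * M = G := by
  have ha : S * Mᵀ = M⁻¹ * S := by
    calc S * Mᵀ = M⁻¹ * (M * (S * Mᵀ)) := (Matrix.nonsing_inv_mul_cancel_left _ _ hM).symm
      _ = M⁻¹ * S := by rw [← Matrix.mul_assoc M S Mᵀ, hiso]
  have hb : Mᵀ = S⁻¹ * (M⁻¹ * S) := by
    rw [← ha, Matrix.nonsing_inv_mul_cancel_left _ _ hS]
  calc Mᵀ * G * M = S⁻¹ * (M⁻¹ * S) * G * M := by rw [hb]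
    _ = S⁻¹ * (M⁻¹ * (S * G * M)) := by simp only [Matrix.mul_assoc]
    _ = S⁻¹ * (M⁻¹ * (M * (S * G))) := by rw [hcomm]
    _ = S⁻¹ * (S * G) := by rw [Matrix.nonsing_inv_mul_cancel_left _ _ hM]
    _ = G := Matrix.nonsing_inv_mul_cancel_left _ _ hS

/-- … and conversely: if `M` is invertible, commutes with `S G` and satisfies `ᵗM G M = G` for an invertible `G`, then `M S ᵗM = S`.
[cite: Lange2023AbelianVarietiesComplex, §7.2.4 Exercise (4)(a)] -/
theorem mul_mul_transpose_eq_of_comm_of_transpose_mul_mul_eq {S G M : Matrix ι ι ℂ} (hG : IsUnit G.det)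
    (hM : IsUnit M.det) (hcomm : M * (S * G) = S * G * M) (hsymp : Mᵀ * G * M = G) : M * S * Mᵀ = S := by
  have hMt : IsUnit Mᵀ.det := by rwa [det_transpose]
  have ha : G * M = Mᵀ⁻¹ * G := by
    calc G * M = Mᵀ⁻¹ * (Mᵀ * (G * M)) := (Matrix.nonsing_inv_mul_cancel_left _ _ hMt).symm
      _ = Mᵀ⁻¹ * G := by rw [← Matrix.mul_assoc Mᵀ G M, hsymp]
  have hb : M * S * G = S * Mᵀ⁻¹ * G := by
    calc M * S * G = M * (S * G) := Matrix.mul_assoc _ _ _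
      _ = S * G * M := hcomm
      _ = S * (G * M) := Matrix.mul_assoc _ _ _
      _ = S * (Mᵀ⁻¹ * G) := by rw [ha]
      _ = S * Mᵀ⁻¹ * G := (Matrix.mul_assoc _ _ _).symm
  have hc : M * S = S * Mᵀ⁻¹ := by
    calc M * S = M * S * G * G⁻¹ := (Matrix.mul_nonsing_inv_cancel_right _ _ hG).symm
      _ = S * Mᵀ⁻¹ * G * G⁻¹ := by rw [hb]
      _ = S * Mᵀ⁻¹ := Matrix.mul_nonsing_inv_cancel_right _ _ hG
  calc M * S * Mᵀ = S * Mᵀ⁻¹ * Mᵀ := by rw [hc]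
    _ = S := Matrix.nonsing_inv_mul_cancel_right _ _ hMt

end LefschetzDet

section Lefschetz

variable {ι : Type} [Fintype ι] [DecidableEq ι] {E : Type} [NormedAddCommGroup E] [NormedSpace ℂ E]
  (Φ : (ι → ℝ) ≃L[ℝ] E) [Literature.AlgebraicGeometry.Motives.HodgeTensorFacts.{0, 0}] [Module.Finite ℚ (rationalForms Φ 1)]

/-- **`S(H¹(X, ℚ))(ℂ)` IS `S(X)(ℂ)` IN LATTICE COORDINATES.** For a complex torus `X = E/Φ(ℤ^ι)`, a form `η` on `X` of type
`(1,1)` with rational non-degenerate Gram matrix `G` on the lattice basis (every polarisation of `X`), EVERY polarization `Q` of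
the weight-one Hodge structure `H¹(X, ℚ)` and every automorphism `γ` of `ℂ ⊗ H¹(X, ℚ)` with `M = hOneMatrix γ` (so
`γ = (M ⊗ 1)^*`): `γ ∈ S_Q(H¹(X, ℚ))(ℂ)` — `γ` commutes with `End_HS(H¹(X, ℚ)) ⊗ ℂ` and preserves `Q_ℂ` — iff `ᵗM G M = G` and
`M A = A M` for all `A ∈ End_ℚ(X)`, i.e. iff `M ∈ S(X)(ℂ)` («the largest algebraic subgroup of `Sp(e_D)` whose elements commute
with the endomorphisms», «for any ample divisor `D`»; «`Lf(X)` does not depend on the polarization»).  The endomorphism clause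
is §2; the form clause trades `Q` (on cohomology) for `E` (on homology) through `[Q] G ∈ End_ℚ(X)` (§4).
[cite: Milne1999LefschetzClasses, §1 p. 644 L16–L20] [cite: Lange2023AbelianVarietiesComplex, §7.2.4 Exercise (4)(a)] -/
theorem mem_lefschetzGroupBaseChange_iff_hOneMatrix (Q : (hodgeStructure Φ 1).Polarization) {η : E [⋀^Fin 2]→L[ℝ] ℝ}
    (h₁₁ : ∀ u v : E, η ![I • u, I • v] = η ![u, v]) {G : Matrix ι ι ℚ} (hG : G.map (Rat.cast : ℚ → ℝ) = latticeGram Φ η)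
    (hGdet : IsUnit G.det) (γ : (ℂ ⊗[ℚ] rationalForms Φ 1) ≃ₗ[ℂ] (ℂ ⊗[ℚ] rationalForms Φ 1)) :
    γ ∈ Q.lefschetzGroupBaseChange ℂ ↔
      (hOneMatrix Φ γ.toLinearMap)ᵀ * G.map (algebraMap ℚ ℂ) *
            hOneMatrix Φ γ.toLinearMap = G.map (algebraMap ℚ ℂ) ∧
        ∀ A ∈ endAlgRat Φ, hOneMatrix Φ γ.toLinearMap * A.map (algebraMap ℚ ℂ) =
          A.map (algebraMap ℚ ℂ) * hOneMatrix Φ γ.toLinearMap := by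
  set S : Matrix ι ι ℚ := LinearMap.BilinForm.toMatrix (coordOneFormBasis Φ) Q.form with hSdef
  have hS : IsUnit (S.map (algebraMap ℚ ℂ)).det := by
    have h := (isUnit_det_polarizationMatrix Φ Q).map (algebraMap ℚ ℂ)
    rwa [RingHom.map_det, RingHom.mapMatrix_apply] at h
  have hGc : IsUnit (G.map (algebraMap ℚ ℂ)).det := by
    have h := hGdet.map (algebraMap ℚ ℂ)
    rwa [RingHom.map_det, RingHom.mapMatrix_apply] at h
  have hM : IsUnit (hOneMatrix Φ γ.toLinearMap).det := isUnit_det_hOneMatrix Φ γ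
  have hφ : S * G ∈ endAlgRat Φ := polarizationMatrix_mul_mem_endAlgRat Φ Q h₁₁ hG
  have hend := forall_endAlg_comm_iff_forall_endAlgRat_comm Φ γ.toLinearMap
  have hform := forall_form_baseChange_eq_iff Φ Q.form γ.toLinearMap
  simp only [LinearEquiv.coe_toLinearMap] at hend hform
  rw [HodgeStructure.Polarization.mem_lefschetzGroupBaseChange_iff, hend, hform, ← hSdef]
  constructor
  · rintro ⟨hcomm, hiso⟩
    refine ⟨?_, hcomm⟩
    have hc := hcomm _ hφ
    rw [Matrix.map_mul] at hc
    exact transpose_mul_mul_eq_of_comm_of_mul_mul_transpose_eq hS hM hc hiso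
  · rintro ⟨hsymp, hcomm⟩
    refine ⟨hcomm, ?_⟩
    have hc := hcomm _ hφ
    rw [Matrix.map_mul] at hc
    exact mul_mul_transpose_eq_of_comm_of_transpose_mul_mul_eq hGc hM hc hsymp

/-- The same for a polarisation `η` of `X` (a Riemann form; `det G ≠ 0` is automatic).
[cite: Milne1999LefschetzClasses, §1 p. 644 L16–L20] [cite: Lange2023AbelianVarietiesComplex, §7.2.4 Exercise (4)(a)] -/
theorem IsRiemannForm.mem_lefschetzGroupBaseChange_iff_hOneMatrix {η : E [⋀^Fin 2]→L[ℝ] ℝ} (hη : IsRiemannForm Φ η)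
    (Q : (hodgeStructure Φ 1).Polarization) {G : Matrix ι ι ℚ} (hG : G.map (Rat.cast : ℚ → ℝ) = latticeGram Φ η)
    (γ : (ℂ ⊗[ℚ] rationalForms Φ 1) ≃ₗ[ℂ] (ℂ ⊗[ℚ] rationalForms Φ 1)) :
    γ ∈ Q.lefschetzGroupBaseChange ℂ ↔
      (hOneMatrix Φ γ.toLinearMap)ᵀ * G.map (algebraMap ℚ ℂ) *
            hOneMatrix Φ γ.toLinearMap = G.map (algebraMap ℚ ℂ) ∧
        ∀ A ∈ endAlgRat Φ, hOneMatrix Φ γ.toLinearMap * A.map (algebraMap ℚ ℂ) =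
          A.map (algebraMap ℚ ℂ) * hOneMatrix Φ γ.toLinearMap :=
  ComplexTorus.mem_lefschetzGroupBaseChange_iff_hOneMatrix Φ Q hη.1 hG (isUnit_det_of_map_ratCast hG hη.isUnit_det_latticeGram) γ

/-- **`γ ∈ S_Q(H¹(X, ℚ))(ℂ) ⟹ hOneMatrix γ ∈ S(X)(ℂ) = lefschetzGroupC Φ G`**: there is an element of `lefschetzGroupC Φ G`
(determinant `1` by `det_hOneMatrix_eq_one_of_mem_lefschetzGroupBaseChange`) whose matrix is `hOneMatrix γ`.
[cite: Milne1999LefschetzClasses, §1 p. 644 L16–L20] [cite: Lange2023AbelianVarietiesComplex, §7.2.4 Exercise (4)] -/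
theorem exists_mem_lefschetzGroupC_coe_eq_hOneMatrix (Q : (hodgeStructure Φ 1).Polarization) {η : E [⋀^Fin 2]→L[ℝ] ℝ}
    (h₁₁ : ∀ u v : E, η ![I • u, I • v] = η ![u, v]) {G : Matrix ι ι ℚ} (hG : G.map (Rat.cast : ℚ → ℝ) = latticeGram Φ η)
    (hGdet : IsUnit G.det) {γ : (ℂ ⊗[ℚ] rationalForms Φ 1) ≃ₗ[ℂ] (ℂ ⊗[ℚ] rationalForms Φ 1)}
    (hγ : γ ∈ Q.lefschetzGroupBaseChange ℂ) :
    ∃ M ∈ lefschetzGroupC Φ G, (M : Matrix ι ι ℂ) = hOneMatrix Φ γ.toLinearMap := by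
  have hdet : Matrix.det (hOneMatrix Φ γ.toLinearMap) = 1 :=
    det_hOneMatrix_eq_one_of_mem_lefschetzGroupBaseChange Φ Q hγ
  have hmem := (mem_lefschetzGroupBaseChange_iff_hOneMatrix Φ Q h₁₁ hG hGdet γ).1 hγ
  exact ⟨⟨_, hdet⟩, (mem_lefschetzGroupC_iff Φ).2 hmem, rfl⟩

/-- The same for a polarisation `η` of `X`. [cite: Milne1999LefschetzClasses, §1 p. 644 L16–L20] -/
theorem IsRiemannForm.exists_mem_lefschetzGroupC_coe_eq_hOneMatrix {η : E [⋀^Fin 2]→L[ℝ] ℝ} (hη : IsRiemannForm Φ η)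
    (Q : (hodgeStructure Φ 1).Polarization) {G : Matrix ι ι ℚ} (hG : G.map (Rat.cast : ℚ → ℝ) = latticeGram Φ η)
    {γ : (ℂ ⊗[ℚ] rationalForms Φ 1) ≃ₗ[ℂ] (ℂ ⊗[ℚ] rationalForms Φ 1)} (hγ : γ ∈ Q.lefschetzGroupBaseChange ℂ) :
    ∃ M ∈ lefschetzGroupC Φ G, (M : Matrix ι ι ℂ) = hOneMatrix Φ γ.toLinearMap :=
  ComplexTorus.exists_mem_lefschetzGroupC_coe_eq_hOneMatrix Φ Q hη.1 hG
    (isUnit_det_of_map_ratCast hG hη.isUnit_det_latticeGram) hγ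

/-- **Conversely, every `M ∈ S(X)(ℂ)` is `hOneMatrix γ` for some `γ ∈ S_Q(H¹(X, ℚ))(ℂ)`** (`γ = (M ⊗ 1)^*`, the
automorphism of `ℂ ⊗ H¹(X, ℚ)` with matrix `ᵗM` in the basis `1 ⊗ dxₐ`): the correspondence is ONTO `lefschetzGroupC Φ G`.
[cite: Milne1999LefschetzClasses, §1 p. 644 L16–L20] [cite: Lange2023AbelianVarietiesComplex, §7.2.4 Exercise (4)] -/
theorem exists_mem_lefschetzGroupBaseChange_hOneMatrix_eq (Q : (hodgeStructure Φ 1).Polarization)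
    {η : E [⋀^Fin 2]→L[ℝ] ℝ} (h₁₁ : ∀ u v : E, η ![I • u, I • v] = η ![u, v]) {G : Matrix ι ι ℚ}
    (hG : G.map (Rat.cast : ℚ → ℝ) = latticeGram Φ η) (hGdet : IsUnit G.det) {M : SpecialLinearGroup ι ℂ}
    (hM : M ∈ lefschetzGroupC Φ G) :
    ∃ γ : (ℂ ⊗[ℚ] rationalForms Φ 1) ≃ₗ[ℂ] (ℂ ⊗[ℚ] rationalForms Φ 1),
      γ ∈ Q.lefschetzGroupBaseChange ℂ ∧ hOneMatrix Φ γ.toLinearMap = M.1 := by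
  have hMt : IsUnit M.1ᵀ.det := by
    rw [det_transpose, M.2]
    exact isUnit_one
  refine ⟨Matrix.toLinearEquiv (coordOneFormBasisC Φ) M.1ᵀ hMt, ?_, hOneMatrix_toLinearEquiv' Φ hMt⟩
  rw [mem_lefschetzGroupBaseChange_iff_hOneMatrix Φ Q h₁₁ hG hGdet, hOneMatrix_toLinearEquiv' Φ hMt]
  exact (mem_lefschetzGroupC_iff Φ).1 hM

/-- The same for a polarisation `η` of `X`. [cite: Milne1999LefschetzClasses, §1 p. 644 L16–L20] -/
theorem IsRiemannForm.exists_mem_lefschetzGroupBaseChange_hOneMatrix_eq {η : E [⋀^Fin 2]→L[ℝ] ℝ}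
    (hη : IsRiemannForm Φ η) (Q : (hodgeStructure Φ 1).Polarization) {G : Matrix ι ι ℚ}
    (hG : G.map (Rat.cast : ℚ → ℝ) = latticeGram Φ η) {M : SpecialLinearGroup ι ℂ} (hM : M ∈ lefschetzGroupC Φ G) :
    ∃ γ : (ℂ ⊗[ℚ] rationalForms Φ 1) ≃ₗ[ℂ] (ℂ ⊗[ℚ] rationalForms Φ 1),
      γ ∈ Q.lefschetzGroupBaseChange ℂ ∧ hOneMatrix Φ γ.toLinearMap = M.1 :=
  ComplexTorus.exists_mem_lefschetzGroupBaseChange_hOneMatrix_eq Φ Q hη.1 hG (isUnit_det_of_map_ratCast hG hη.isUnit_det_latticeGram) hM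

end Lefschetz

end ComplexTorus

end Literature.Geometry.Kaehler

end
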